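import Summits.KontsevichZagierPeriods.KontsevichZagierPeriods.Theorems.FurushoPentagonPentagonInKZCornerEngineMirror
import Summits.KontsevichZagierPeriods.KontsevichZagierPeriods.Theorems.FurushoPentagonPentagonInKZCornerEngineSplit
import Summits.KontsevichZagierPeriods.KontsevichZagierPeriods.Theorems.FurushoPentagonPentagonInKZCornerEngineEdges
import Summits.KontsevichZagierPeriods.KontsevichZagierPeriods.Theorems.FurushoPentagonPentagonInKZCornerEngineEuler
import Summits.KontsevichZagierPeriods.KontsevichZagierPeriods.Theorems.FurushoPentagonPentagonInKZCornerEngineDirect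

/-!
# `PentagonInKZ`, line `edge-normal-newton-leibniz`: corner engine — summed edge decomposition and level `n − 2`

Over the abstract signature: the decomposition of the defect along the two edges summed over a
degree (`decomp_sum`), and the level-`(n−2)` terms of one side summed over the degree in the
direct (`low_side`) and the reversed (`low_side_rev`, used at the mirror) indexing.

References: M. Kontsevich, D. Zagier, *Periods* (2001), §1.2; V. G. Drinfeld, Leningrad Math. J. 2
(1991), §2.
-/

noncomputable section

open Set MeasureTheory
open Literature.NumberTheory.Transcendental
open Literature.ModelTheory.ExponentialFields (IsSemialgebraic)

namespace Summit.KontsevichZagierPeriods.FurushoPentagon.PentagonInKZ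

section AbstractEngine

variable {m N : ℕ} {ℓ ℓ' : Fin (m + 2)} {α β : ℚ}
  {Zq : Fin (m + 2) → (DrinfeldKohnoTrunc ℚ (Fin 4) N)} {wZ : ∀ {n : ℕ}, (Fin n → Fin (m + 2)) → (DrinfeldKohnoTrunc ℚ (Fin 4) N)}
  {fd gd dd : Fin (m + 2) → ℝ → ℝ → ℝ}
  {Ht Vt dHt dVt : ∀ {n : ℕ}, (Fin n → Fin (m + 2)) → (Fin n → ℝ) → ℝ → ℝ → ℝ}
  {op opV : Fin (m + 2) → (DrinfeldKohnoTrunc ℚ (Fin 4) N) →ₗ[ℚ] (DrinfeldKohnoTrunc ℚ (Fin 4) N)}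
  {Af Bf dAf dBf F : ((DrinfeldKohnoTrunc ℚ (Fin 4) N) →ₗ[ℚ] ℚ) → ∀ {k l : ℕ}, (Fin k → ℝ) → (Fin l → ℝ) → ℝ → ℝ → ℝ}
  {Xb : ∀ k l e : ℕ, (Fin (k + l + e) → ℝ) → Fin k → ℝ}
  {Yb : ∀ k l e : ℕ, (Fin (k + l + e) → ℝ) → Fin l → ℝ}
  {Θb : ∀ k l e : ℕ, (Fin (k + l + e) → ℝ) → Fin e → ℝ}

variable (H :
    (∀ {n : ℕ} (U : Fin n → Fin (m + 2)), wZ U = ((List.ofFn U).map Zq).prod) ∧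
    (∀ (a : Fin (m + 2)) (X : (DrinfeldKohnoTrunc ℚ (Fin 4) N)), op a X = if a = ℓ then Zq ℓ * X - X * Zq ℓ else Zq a * X) ∧
    (∀ (b : Fin (m + 2)) (X : (DrinfeldKohnoTrunc ℚ (Fin 4) N)), opV b X = if b = ℓ' then Zq ℓ' * X - X * Zq ℓ' else Zq b * X) ∧
    (∀ (μ : (DrinfeldKohnoTrunc ℚ (Fin 4) N) →ₗ[ℚ] ℚ) {k l : ℕ} (x : Fin k → ℝ) (y : Fin l → ℝ) (ξ η : ℝ), Af μ x y ξ η = ∑ U : Fin k → Fin (m + 2), ∑ V : Fin l → Fin (m + 2), (μ (wZ U * wZ V) : ℝ) * (Ht U x ξ η * Vt V y 0 η)) ∧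
    (∀ (μ : (DrinfeldKohnoTrunc ℚ (Fin 4) N) →ₗ[ℚ] ℚ) {k l : ℕ} (x : Fin k → ℝ) (y : Fin l → ℝ) (ξ η : ℝ), Bf μ x y ξ η = ∑ U : Fin k → Fin (m + 2), ∑ V : Fin l → Fin (m + 2), (μ (wZ V * wZ U) : ℝ) * (Vt V y ξ η * Ht U x ξ 0)) ∧
    (∀ (μ : (DrinfeldKohnoTrunc ℚ (Fin 4) N) →ₗ[ℚ] ℚ) {k l : ℕ} (x : Fin k → ℝ) (y : Fin l → ℝ) (ξ η : ℝ), dAf μ x y ξ η = ∑ U : Fin k → Fin (m + 2), ∑ V : Fin l → Fin (m + 2), (μ (wZ U * wZ V) : ℝ) * (dHt U x ξ η * Vt V y 0 η)) ∧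
    (∀ (μ : (DrinfeldKohnoTrunc ℚ (Fin 4) N) →ₗ[ℚ] ℚ) {k l : ℕ} (x : Fin k → ℝ) (y : Fin l → ℝ) (ξ η : ℝ), dBf μ x y ξ η = ∑ U : Fin k → Fin (m + 2), ∑ V : Fin l → Fin (m + 2), (μ (wZ V * wZ U) : ℝ) * (dVt V y ξ η * Ht U x ξ 0)) ∧
    (∀ (μ : (DrinfeldKohnoTrunc ℚ (Fin 4) N) →ₗ[ℚ] ℚ) {k l : ℕ} (x : Fin k → ℝ) (y : Fin l → ℝ) (ξ η : ℝ), F μ x y ξ η = Af μ x y ξ η - Bf μ x y ξ η) ∧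
    (∀ (k l e : ℕ) (z : Fin (k + l + e) → ℝ), Xb k l e z = fun i => z (Fin.castAdd e (Fin.castAdd l i))) ∧
    (∀ (k l e : ℕ) (z : Fin (k + l + e) → ℝ), Yb k l e z = fun j => z (Fin.castAdd e (Fin.natAdd k j))) ∧
    (∀ (k l e : ℕ) (z : Fin (k + l + e) → ℝ), Θb k l e z = fun s => z (Fin.natAdd (k + l) s)) ∧
    (∀ (U : Fin 0 → Fin (m + 2)) (x : Fin 0 → ℝ) (ξ η : ℝ), Ht U x ξ η = 1) ∧
    (∀ (V : Fin 0 → Fin (m + 2)) (y : Fin 0 → ℝ) (ξ η : ℝ), Vt V y ξ η = 1) ∧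
    (∀ (U : Fin 0 → Fin (m + 2)) (x : Fin 0 → ℝ) (ξ η : ℝ), dHt U x ξ η = 0) ∧
    (∀ (V : Fin 0 → Fin (m + 2)) (y : Fin 0 → ℝ) (ξ η : ℝ), dVt V y ξ η = 0) ∧
    (∀ {k : ℕ} (U : Fin (k + 1) → Fin (m + 2)) (x : Fin (k + 1) → ℝ) (η : ℝ), Ht U x 0 η = 0) ∧
    (∀ {l : ℕ} (V : Fin (l + 1) → Fin (m + 2)) (y : Fin (l + 1) → ℝ) (ξ : ℝ), Vt V y ξ 0 = 0) ∧
    (∀ t y : ℝ, fd ℓ t y = 1 / t) ∧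
    (∀ x s : ℝ, gd ℓ' x s = 1 / s) ∧
    (∀ x y : ℝ, dd ℓ x y = 0) ∧
    (∀ x y : ℝ, dd ℓ' x y = 0) ∧
    (∀ (μ : (DrinfeldKohnoTrunc ℚ (Fin 4) N) →ₗ[ℚ] ℚ) {k : ℕ} (x₀ : ℝ) (x' : Fin k → ℝ) (ξ η : ℝ), ∑ U : Fin (k + 1) → Fin (m + 2), (μ (wZ U) : ℝ) * Ht U (Fin.cons x₀ x') ξ η = (∑ a : Fin (m + 2), (if a = ℓ then 1 / x₀ else ξ * fd a (ξ * x₀) η) * ∑ U' : Fin k → Fin (m + 2), (μ (Zq a * wZ U') : ℝ) * Ht U' x' (ξ * x₀) η) - (1 / x₀) * ∑ U' : Fin k → Fin (m + 2), (μ (wZ U' * Zq ℓ) : ℝ) * Ht U' x' (ξ * x₀) η) ∧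
    (∀ (μ : (DrinfeldKohnoTrunc ℚ (Fin 4) N) →ₗ[ℚ] ℚ) {l : ℕ} (y₀ : ℝ) (y' : Fin l → ℝ) (ξ η : ℝ), ∑ V : Fin (l + 1) → Fin (m + 2), (μ (wZ V) : ℝ) * Vt V (Fin.cons y₀ y') ξ η = (∑ b : Fin (m + 2), (if b = ℓ' then 1 / y₀ else η * gd b ξ (η * y₀)) * ∑ V' : Fin l → Fin (m + 2), (μ (Zq b * wZ V') : ℝ) * Vt V' y' ξ (η * y₀)) - (1 / y₀) * ∑ V' : Fin l → Fin (m + 2), (μ (wZ V' * Zq ℓ') : ℝ) * Vt V' y' ξ (η * y₀)) ∧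
    (∀ (μ : (DrinfeldKohnoTrunc ℚ (Fin 4) N) →ₗ[ℚ] ℚ) {l : ℕ} (P Q : (DrinfeldKohnoTrunc ℚ (Fin 4) N)) (y : Fin l → ℝ) (η : ℝ), (∀ i, 0 < y i ∧ y i < 1) → 0 < η → η ≤ (β : ℝ) → ∑ V : Fin l → Fin (m + 2), (μ (P * (Zq ℓ * wZ V - wZ V * Zq ℓ) * Q) : ℝ) * Vt V y 0 η = 0) ∧
    (∀ (μ : (DrinfeldKohnoTrunc ℚ (Fin 4) N) →ₗ[ℚ] ℚ) {k : ℕ} (P Q : (DrinfeldKohnoTrunc ℚ (Fin 4) N)) (x : Fin k → ℝ) (ξ : ℝ), (∀ i, 0 < x i ∧ x i < 1) → 0 < ξ → ξ ≤ (α : ℝ) → ∑ U : Fin k → Fin (m + 2), (μ (P * (Zq ℓ' * wZ U - wZ U * Zq ℓ') * Q) : ℝ) * Ht U x ξ 0 = 0) ∧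
    (∀ (μ : (DrinfeldKohnoTrunc ℚ (Fin 4) N) →ₗ[ℚ] ℚ) (P Q : (DrinfeldKohnoTrunc ℚ (Fin 4) N)), μ (P * (Zq ℓ * Zq ℓ' - Zq ℓ' * Zq ℓ) * Q) = 0) ∧
    (∀ (μ : (DrinfeldKohnoTrunc ℚ (Fin 4) N) →ₗ[ℚ] ℚ) (P Q : (DrinfeldKohnoTrunc ℚ (Fin 4) N)) (x y : ℝ), 0 < x → x < (α : ℝ) → 0 < y → y < (β : ℝ) → ∑ a : Fin (m + 2), ∑ b : Fin (m + 2), (fd a x y * gd b x y) * (μ (P * (Zq a * Zq b - Zq b * Zq a) * Q) : ℝ) = 0) ∧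
    (∀ (μ : (DrinfeldKohnoTrunc ℚ (Fin 4) N) →ₗ[ℚ] ℚ) (P Q : (DrinfeldKohnoTrunc ℚ (Fin 4) N)) (s : ℝ), 0 < s → s < (β : ℝ) → ∑ b : Fin (m + 2), gd b 0 s * (μ (P * (Zq ℓ * Zq b - Zq b * Zq ℓ) * Q) : ℝ) = 0) ∧
    (∀ (μ : (DrinfeldKohnoTrunc ℚ (Fin 4) N) →ₗ[ℚ] ℚ) (P Q : (DrinfeldKohnoTrunc ℚ (Fin 4) N)) (t : ℝ), 0 < t → t < (α : ℝ) → ∑ a : Fin (m + 2), fd a t 0 * (μ (P * (Zq ℓ' * Zq a - Zq a * Zq ℓ') * Q) : ℝ) = 0) ∧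
    (∀ (a : Fin (m + 2)) (ξ η : ℝ), 0 ≤ ξ → ξ ≤ (α : ℝ) → 0 ≤ η → η ≤ (β : ℝ) → HasDerivAt (fun y => fd a ξ y) (dd a ξ η) η) ∧
    (∀ (b : Fin (m + 2)) (ξ η : ℝ), 0 ≤ ξ → ξ ≤ (α : ℝ) → 0 ≤ η → η ≤ (β : ℝ) → HasDerivAt (fun x => gd b x η) (dd b ξ η) ξ) ∧
    (∀ {k : ℕ} (U : Fin k → Fin (m + 2)) (x : Fin k → ℝ) (ξ η : ℝ), (∀ i, 0 ≤ x i ∧ x i ≤ 1) → 0 ≤ ξ → ξ ≤ (α : ℝ) → 0 ≤ η → η ≤ (β : ℝ) → HasDerivAt (fun t => Ht U x t η) (dHt U x ξ η) ξ) ∧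
    (∀ {l : ℕ} (V : Fin l → Fin (m + 2)) (y : Fin l → ℝ) (ξ η : ℝ), (∀ i, 0 ≤ y i ∧ y i ≤ 1) → 0 ≤ ξ → ξ ≤ (α : ℝ) → 0 ≤ η → η ≤ (β : ℝ) → HasDerivAt (fun s => Vt V y ξ s) (dVt V y ξ η) η) ∧
    (∀ {k : ℕ} (U : Fin (k + 1) → Fin (m + 2)) (x₀ : ℝ) (x' : Fin k → ℝ) (ξ η : ℝ), 0 < x₀ → x₀ < 1 → (∀ i, 0 ≤ x' i ∧ x' i ≤ 1) → 0 ≤ ξ → ξ ≤ (α : ℝ) → 0 ≤ η → η ≤ (β : ℝ) → HasDerivAt (fun t => t * Ht U (Fin.cons t x') ξ η) (ξ * dHt U (Fin.cons x₀ x') ξ η) x₀) ∧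
    (∀ {l : ℕ} (V : Fin (l + 1) → Fin (m + 2)) (y₀ : ℝ) (y' : Fin l → ℝ) (ξ η : ℝ), 0 < y₀ → y₀ < 1 → (∀ i, 0 ≤ y' i ∧ y' i ≤ 1) → 0 ≤ ξ → ξ ≤ (α : ℝ) → 0 ≤ η → η ≤ (β : ℝ) → HasDerivAt (fun t => t * Vt V (Fin.cons t y') ξ η) (η * dVt V (Fin.cons y₀ y') ξ η) y₀) ∧
    (∀ {k : ℕ} (U : Fin (k + 1) → Fin (m + 2)) (x' : Fin k → ℝ) (ξ η : ℝ), (∀ i, 0 ≤ x' i ∧ x' i ≤ 1) → 0 ≤ ξ → ξ ≤ (α : ℝ) → 0 ≤ η → η ≤ (β : ℝ) → ContinuousOn (fun t => t * Ht U (Fin.cons t x') ξ η) (Set.Icc 0 1)) ∧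
    (∀ {l : ℕ} (V : Fin (l + 1) → Fin (m + 2)) (y' : Fin l → ℝ) (ξ η : ℝ), (∀ i, 0 ≤ y' i ∧ y' i ≤ 1) → 0 ≤ ξ → ξ ≤ (α : ℝ) → 0 ≤ η → η ≤ (β : ℝ) → ContinuousOn (fun t => t * Vt V (Fin.cons t y') ξ η) (Set.Icc 0 1)) ∧
    (∀ {d : ℕ} {W : Set (Fin d → ℝ)}, IsSemialgebraic ℚ W → ∀ (a : Fin (m + 2)) {T Y : (Fin d → ℝ) → ℝ}, IsSemialgebraicFunOn ℚ W T → IsSemialgebraicFunOn ℚ W Y → IsSemialgebraicFunOn ℚ W fun z => fd a (T z) (Y z)) ∧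
    (∀ {d : ℕ} {W : Set (Fin d → ℝ)}, IsSemialgebraic ℚ W → ∀ (b : Fin (m + 2)) {T Y : (Fin d → ℝ) → ℝ}, IsSemialgebraicFunOn ℚ W T → IsSemialgebraicFunOn ℚ W Y → IsSemialgebraicFunOn ℚ W fun z => gd b (T z) (Y z)) ∧
    (∀ {d : ℕ} {W : Set (Fin d → ℝ)}, IsSemialgebraic ℚ W → ∀ (a : Fin (m + 2)) {T Y : (Fin d → ℝ) → ℝ}, IsSemialgebraicFunOn ℚ W T → IsSemialgebraicFunOn ℚ W Y → IsSemialgebraicFunOn ℚ W fun z => dd a (T z) (Y z)) ∧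
    (∀ {d : ℕ} {W : Set (Fin d → ℝ)}, IsSemialgebraic ℚ W → ∀ {n : ℕ} (U : Fin n → Fin (m + 2)) {X : (Fin d → ℝ) → Fin n → ℝ} {P Q : (Fin d → ℝ) → ℝ}, (∀ i, IsSemialgebraicFunOn ℚ W fun z => X z i) → IsSemialgebraicFunOn ℚ W P → IsSemialgebraicFunOn ℚ W Q → IsSemialgebraicFunOn ℚ W fun z => Ht U (X z) (P z) (Q z)) ∧
    (∀ {d : ℕ} {W : Set (Fin d → ℝ)}, IsSemialgebraic ℚ W → ∀ {n : ℕ} (V : Fin n → Fin (m + 2)) {Y : (Fin d → ℝ) → Fin n → ℝ} {P Q : (Fin d → ℝ) → ℝ}, (∀ i, IsSemialgebraicFunOn ℚ W fun z => Y z i) → IsSemialgebraicFunOn ℚ W P → IsSemialgebraicFunOn ℚ W Q → IsSemialgebraicFunOn ℚ W fun z => Vt V (Y z) (P z) (Q z)) ∧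
    (∀ {d : ℕ} {W : Set (Fin d → ℝ)}, IsSemialgebraic ℚ W → ∀ {n : ℕ} (U : Fin n → Fin (m + 2)) {X : (Fin d → ℝ) → Fin n → ℝ} {P Q : (Fin d → ℝ) → ℝ}, (∀ i, IsSemialgebraicFunOn ℚ W fun z => X z i) → IsSemialgebraicFunOn ℚ W P → IsSemialgebraicFunOn ℚ W Q → IsSemialgebraicFunOn ℚ W fun z => dHt U (X z) (P z) (Q z)) ∧
    (∀ {d : ℕ} {W : Set (Fin d → ℝ)}, IsSemialgebraic ℚ W → ∀ {n : ℕ} (V : Fin n → Fin (m + 2)) {Y : (Fin d → ℝ) → Fin n → ℝ} {P Q : (Fin d → ℝ) → ℝ}, (∀ i, IsSemialgebraicFunOn ℚ W fun z => Y z i) → IsSemialgebraicFunOn ℚ W P → IsSemialgebraicFunOn ℚ W Q → IsSemialgebraicFunOn ℚ W fun z => dVt V (Y z) (P z) (Q z)) ∧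
    (∃ C : ℝ, ∀ (a : Fin (m + 2)) (ξ η : ℝ), 0 ≤ ξ → ξ ≤ (α : ℝ) → 0 ≤ η → η ≤ (β : ℝ) → (a ≠ ℓ → |fd a ξ η| ≤ C) ∧ (a ≠ ℓ' → |gd a ξ η| ≤ C) ∧ |dd a ξ η| ≤ C ∧ (∀ η' : ℝ, 0 ≤ η' → η' ≤ (β : ℝ) → |fd a ξ η - fd a ξ η'| ≤ C * |η - η'|) ∧ (∀ ξ' : ℝ, 0 ≤ ξ' → ξ' ≤ (α : ℝ) → |gd a ξ η - gd a ξ' η| ≤ C * |ξ - ξ'|)) ∧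
    (∀ k : ℕ, ∃ C : ℝ, ∀ (U : Fin k → Fin (m + 2)) (x : Fin k → ℝ) (ξ η : ℝ), (∀ i, 0 ≤ x i ∧ x i ≤ 1) → 0 ≤ ξ → ξ ≤ (α : ℝ) → 0 ≤ η → η ≤ (β : ℝ) → |Ht U x ξ η| ≤ C ∧ |dHt U x ξ η| ≤ C ∧ (0 < k → |Ht U x ξ η| ≤ C * ξ) ∧ (∀ η' : ℝ, 0 ≤ η' → η' ≤ (β : ℝ) → |Ht U x ξ η - Ht U x ξ η'| ≤ C * ξ * |η - η'|)) ∧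
    (∀ l : ℕ, ∃ C : ℝ, ∀ (V : Fin l → Fin (m + 2)) (y : Fin l → ℝ) (ξ η : ℝ), (∀ i, 0 ≤ y i ∧ y i ≤ 1) → 0 ≤ ξ → ξ ≤ (α : ℝ) → 0 ≤ η → η ≤ (β : ℝ) → |Vt V y ξ η| ≤ C ∧ |dVt V y ξ η| ≤ C ∧ (0 < l → |Vt V y ξ η| ≤ C * η) ∧ (∀ ξ' : ℝ, 0 ≤ ξ' → ξ' ≤ (α : ℝ) → |Vt V y ξ η - Vt V y ξ' η| ≤ C * η * |ξ - ξ'|)))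

/-! ### The edge decomposition, summed -/

include H in
/-- **The decomposition of the defect along the two edges, summed over a degree**:
`Σ_k ⟦σ F_{k, n'+1-k}⟧ = Σ_{k'} ⟦σ 𝔄_{k'+1}⟧ − Σ_{k₂} ⟦σ 𝔅_{k₂}⟧` with `𝔄 = A(Ξ,Η) − A(Ξ,0)` in degrees
`(k'+1, n'-k')` and `𝔅 = B(Ξ,Η) − B(0,Η)` in degrees `(k₂, n'-k₂+1)` (`decomp_left/mid/right`,
re-associating the dimensions). [folklore] -/
theorem decomp_sum (μ : (DrinfeldKohnoTrunc ℚ (Fin 4) N) →ₗ[ℚ] ℚ) (n' e : ℕ) (Ξ Η σ' : (Fin e → ℝ) → ℝ)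
    (R : (k : Fin (n' + 1 + 1)) → KZ.IntegralRep ((k : ℕ) + (n' + 1 - k) + e))
    (hR' : ∀ k : Fin (n' + 1 + 1), (R k).domain = KZ.cube ((k : ℕ) + (n' + 1 - k) + e) ∧
      EqOn (R k).integrand (fun z => σ' (Θb k (n' + 1 - k) e z) *
        F μ (Xb k (n' + 1 - k) e z) (Yb k (n' + 1 - k) e z) (Ξ (Θb k (n' + 1 - k) e z)) (Η (Θb k (n' + 1 - k) e z)))
        (KZ.cube ((k : ℕ) + (n' + 1 - k) + e)))
    (RA : (k' : Fin (n' + 1)) → KZ.IntegralRep ((k' : ℕ) + 1 + (n' - k') + e))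
    (hRAd : ∀ k', (RA k').domain = KZ.cube ((k' : ℕ) + 1 + (n' - k') + e))
    (hRAi : ∀ k', (RA k').integrand = fun z => σ' (Θb ((k' : ℕ) + 1) (n' - k') e z) *
      (Af μ (Xb ((k' : ℕ) + 1) (n' - k') e z) (Yb ((k' : ℕ) + 1) (n' - k') e z) (Ξ (Θb ((k' : ℕ) + 1) (n' - k') e z))
          (Η (Θb ((k' : ℕ) + 1) (n' - k') e z)) -
        Af μ (Xb ((k' : ℕ) + 1) (n' - k') e z) (Yb ((k' : ℕ) + 1) (n' - k') e z) (Ξ (Θb ((k' : ℕ) + 1) (n' - k') e z)) 0))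
    (RB : (k₂ : Fin (n' + 1)) → KZ.IntegralRep ((k₂ : ℕ) + (n' - k₂ + 1) + e))
    (hRBd : ∀ k₂, (RB k₂).domain = KZ.cube ((k₂ : ℕ) + (n' - k₂ + 1) + e))
    (hRBi : ∀ k₂, (RB k₂).integrand = fun z => σ' (Θb (k₂ : ℕ) (n' - k₂ + 1) e z) *
      (Bf μ (Xb (k₂ : ℕ) (n' - k₂ + 1) e z) (Yb (k₂ : ℕ) (n' - k₂ + 1) e z) (Ξ (Θb (k₂ : ℕ) (n' - k₂ + 1) e z))
          (Η (Θb (k₂ : ℕ) (n' - k₂ + 1) e z)) -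
        Bf μ (Xb (k₂ : ℕ) (n' - k₂ + 1) e z) (Yb (k₂ : ℕ) (n' - k₂ + 1) e z) 0 (Η (Θb (k₂ : ℕ) (n' - k₂ + 1) e z)))) :
    ∑ k : Fin (n' + 1 + 1), KZ.toPeriodAlgebra (KZ.toFormalPeriod (KZ.of (R k))) =
      ∑ k' : Fin (n' + 1), KZ.toPeriodAlgebra (KZ.toFormalPeriod (KZ.of (RA k'))) -
        ∑ k₂ : Fin (n' + 1), KZ.toPeriodAlgebra (KZ.toFormalPeriod (KZ.of (RB k₂))) := by
  have key : ∀ k : Fin (n' + 1 + 1), KZ.toPeriodAlgebra (KZ.toFormalPeriod (KZ.of (R k))) =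
      Fin.cons (α := fun _ => KZ.FormalPeriodAlgebra) (0 : KZ.FormalPeriodAlgebra)
          (fun k' : Fin (n' + 1) => KZ.toPeriodAlgebra (KZ.toFormalPeriod (KZ.of (RA k')))) k -
        Fin.snoc (α := fun _ => KZ.FormalPeriodAlgebra)
          (fun k₂ : Fin (n' + 1) => KZ.toPeriodAlgebra (KZ.toFormalPeriod (KZ.of (RB k₂)))) (0 : KZ.FormalPeriodAlgebra) k := by
    intro k
    refine Fin.lastCases ?_ (fun j => ?_) k
    · rw [Fin.snoc_last, sub_zero, ← Fin.succ_last, Fin.cons_succ]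
      obtain ⟨R', hd, hi, hc⟩ := recast_rep (e := e) (k₁ := (((Fin.last n').succ : Fin (n' + 1 + 1)) : ℕ))
        (k₂ := n' + 1) (l₁ := n' + 1 - (((Fin.last n').succ : Fin (n' + 1 + 1)) : ℕ)) (l₂ := 0) (by simp) (by simp)
        (fun k l z => σ' (Θb k l e z) * F μ (Xb k l e z) (Yb k l e z) (Ξ (Θb k l e z)) (Η (Θb k l e z)))
        (R (Fin.last n').succ) (hR' _).1 (hR' _).2
      obtain ⟨RA', hdA, hiA, hcA⟩ := recast_rep_eq (e := e) (k₁ := ((Fin.last n' : Fin (n' + 1)) : ℕ) + 1)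
        (k₂ := n' + 1) (l₁ := n' - ((Fin.last n' : Fin (n' + 1)) : ℕ)) (l₂ := 0) (by simp) (by simp)
        (fun k l z => σ' (Θb k l e z) * (Af μ (Xb k l e z) (Yb k l e z) (Ξ (Θb k l e z)) (Η (Θb k l e z)) -
          Af μ (Xb k l e z) (Yb k l e z) (Ξ (Θb k l e z)) 0))
        (RA (Fin.last n')) (hRAd _) (hRAi _)
      rw [← hc, ← hcA]
      exact decomp_right H μ n' e Ξ Η σ' R' hd hi RA' hdA hiA
    · rw [Fin.snoc_castSucc]
      refine Fin.cases ?_ (fun j' => ?_) j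
      · rw [Fin.castSucc_zero, Fin.cons_zero, zero_sub]
        obtain ⟨R', hd, hi, hc⟩ := recast_rep (e := e) (k₁ := ((0 : Fin (n' + 1 + 1)) : ℕ)) (k₂ := 0)
          (l₁ := n' + 1 - ((0 : Fin (n' + 1 + 1)) : ℕ)) (l₂ := n' + 1) (by simp) (by simp)
          (fun k l z => σ' (Θb k l e z) * F μ (Xb k l e z) (Yb k l e z) (Ξ (Θb k l e z)) (Η (Θb k l e z)))
          (R 0) (hR' 0).1 (hR' 0).2
        obtain ⟨RB', hdB, hiB, hcB⟩ := recast_rep_eq (e := e) (k₁ := ((0 : Fin (n' + 1)) : ℕ)) (k₂ := 0)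
          (l₁ := n' - ((0 : Fin (n' + 1)) : ℕ) + 1) (l₂ := n' + 1) (by simp) (by simp)
          (fun k l z => σ' (Θb k l e z) * (Bf μ (Xb k l e z) (Yb k l e z) (Ξ (Θb k l e z)) (Η (Θb k l e z)) -
            Bf μ (Xb k l e z) (Yb k l e z) 0 (Η (Θb k l e z))))
          (RB 0) (hRBd 0) (hRBi 0)
        rw [← hc, ← hcB]
        exact decomp_left H μ n' e Ξ Η σ' R' hd hi RB' hdB hiB
      · rw [Fin.castSucc_succ, Fin.cons_succ]
        obtain ⟨R', hd, hi, hc⟩ := recast_rep (e := e) (k₁ := (((Fin.castSucc j').succ : Fin (n' + 1 + 1)) : ℕ))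
          (k₂ := (j' : ℕ) + 1) (l₁ := n' + 1 - (((Fin.castSucc j').succ : Fin (n' + 1 + 1)) : ℕ))
          (l₂ := n' - 1 - j' + 1) (by simp) (by simp; omega)
          (fun k l z => σ' (Θb k l e z) * F μ (Xb k l e z) (Yb k l e z) (Ξ (Θb k l e z)) (Η (Θb k l e z)))
          (R (Fin.castSucc j').succ) (hR' _).1 (hR' _).2
        obtain ⟨RA', hdA, hiA, hcA⟩ := recast_rep_eq (e := e) (k₁ := ((Fin.castSucc j' : Fin (n' + 1)) : ℕ) + 1)
          (k₂ := (j' : ℕ) + 1) (l₁ := n' - ((Fin.castSucc j' : Fin (n' + 1)) : ℕ)) (l₂ := n' - 1 - j' + 1)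
          (by simp) (by simp; omega)
          (fun k l z => σ' (Θb k l e z) * (Af μ (Xb k l e z) (Yb k l e z) (Ξ (Θb k l e z)) (Η (Θb k l e z)) -
            Af μ (Xb k l e z) (Yb k l e z) (Ξ (Θb k l e z)) 0))
          (RA (Fin.castSucc j')) (hRAd _) (hRAi _)
        obtain ⟨RB', hdB, hiB, hcB⟩ := recast_rep_eq (e := e) (k₁ := ((j'.succ : Fin (n' + 1)) : ℕ))
          (k₂ := (j' : ℕ) + 1) (l₁ := n' - ((j'.succ : Fin (n' + 1)) : ℕ) + 1) (l₂ := n' - 1 - j' + 1)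
          (by simp) (by simp; omega)
          (fun k l z => σ' (Θb k l e z) * (Bf μ (Xb k l e z) (Yb k l e z) (Ξ (Θb k l e z)) (Η (Θb k l e z)) -
            Bf μ (Xb k l e z) (Yb k l e z) 0 (Η (Θb k l e z))))
          (RB j'.succ) (hRBd _) (hRBi _)
        rw [← hc, ← hcA, ← hcB]
        exact decomp_mid H μ j' (n' - 1 - j') e Ξ Η σ' R' hd hi RA' RB' hdA hdB hiA hiB
  have e1 : ∑ k : Fin (n' + 1 + 1), Fin.cons (α := fun _ => KZ.FormalPeriodAlgebra) (0 : KZ.FormalPeriodAlgebra)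
      (fun k' : Fin (n' + 1) => KZ.toPeriodAlgebra (KZ.toFormalPeriod (KZ.of (RA k')))) k =
      ∑ k' : Fin (n' + 1), KZ.toPeriodAlgebra (KZ.toFormalPeriod (KZ.of (RA k'))) := by
    rw [Fin.sum_univ_succ]; simp only [Fin.cons_zero, Fin.cons_succ, zero_add]
  have e2 : ∑ k : Fin (n' + 1 + 1), Fin.snoc (α := fun _ => KZ.FormalPeriodAlgebra)
      (fun k₂ : Fin (n' + 1) => KZ.toPeriodAlgebra (KZ.toFormalPeriod (KZ.of (RB k₂)))) (0 : KZ.FormalPeriodAlgebra) k =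
      ∑ k₂ : Fin (n' + 1), KZ.toPeriodAlgebra (KZ.toFormalPeriod (KZ.of (RB k₂))) := by
    rw [Fin.sum_univ_castSucc]; simp only [Fin.snoc_castSucc, Fin.snoc_last, add_zero]
  rw [Finset.sum_congr rfl fun k _ => key k, Finset.sum_sub_distrib, e1, e2]

/-! ### The level-(n−2) terms of one side -/

include H in
/-- **The level-`(n−2)` terms of one side, summed over the degree**: the `dB`-terms `W₂ k' a`
(`a ≠ ℓ`, Euler step `stepA_euler`) and the regularised height differences `Q k' ℓ` (direct route
`stepA_direct`) of degree `(k', n'−k')` are, for `k' < n'`, the level-`(n−2)` terms `E k'' a` of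
degree `(k'', n'−1−k'')`, and vanish for `k' = n'` (`stepA_euler_nil`, `stepA_direct_nil`).
[cite: KontsevichZagier2001, §1.2 rules (2), (3)] -/
theorem low_side (μ : (DrinfeldKohnoTrunc ℚ (Fin 4) N) →ₗ[ℚ] ℚ) (n' e : ℕ) (Ξ Η σ' : (Fin e → ℝ) → ℝ)
    (hΞΗ : ∀ θ ∈ KZ.cube e, 0 ≤ Ξ θ ∧ Ξ θ ≤ (α : ℝ) ∧ 0 ≤ Η θ ∧ Η θ ≤ (β : ℝ))
    (hσ'0 : ∀ θ ∈ KZ.cube e, Ξ θ = 0 ∨ Η θ = 0 → σ' θ = 0)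
    (hsaΞ : IsSemialgebraicFunOn ℚ (KZ.cube e) Ξ) (hsaΗ : IsSemialgebraicFunOn ℚ (KZ.cube e) Η)
    (hsaσ' : IsSemialgebraicFunOn ℚ (KZ.cube e) σ')
    (Ξ₁ Η₁ ρ : (Fin (e + 1) → ℝ) → ℝ)
    (hΞ₁ : ∀ θ', Ξ₁ θ' = Ξ (Fin.init θ') * θ' (Fin.last e)) (hΗ₁ : ∀ θ', Η₁ θ' = Η (Fin.init θ'))
    (hρ : ∀ θ', ρ θ' = σ' (Fin.init θ') * Ξ (Fin.init θ'))
    (Ξ₂ Η₂ ρ₂ : (Fin (e + 2) → ℝ) → ℝ)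
    (hΞ₂ : ∀ θ'', Ξ₂ θ'' = Ξ (Fin.init (Fin.init θ'')) * θ'' (Fin.castSucc (Fin.last e)))
    (hΗ₂ : ∀ θ'', Η₂ θ'' = Η (Fin.init (Fin.init θ'')) * θ'' (Fin.last (e + 1)))
    (hρ₂ : ∀ θ'', ρ₂ θ'' = σ' (Fin.init (Fin.init θ'')) * Ξ (Fin.init (Fin.init θ'')) * Η (Fin.init (Fin.init θ'')))
    (W₂ : (k' : Fin (n' + 1)) → Fin (m + 2) → KZ.IntegralRep ((k' : ℕ) + (n' - k') + (e + 2)))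
    (hW₂d : ∀ k' a, (W₂ k' a).domain = KZ.cube ((k' : ℕ) + (n' - k') + (e + 2)))
    (hW₂i : ∀ k' a, a ≠ ℓ → (W₂ k' a).integrand = fun w => ρ₂ (Θb (k' : ℕ) (n' - k') (e + 2) w) *
      (fd a (Ξ₂ (Θb (k' : ℕ) (n' - k') (e + 2) w)) (Η₂ (Θb (k' : ℕ) (n' - k') (e + 2) w)) *
        dBf (μ ∘ₗ op a) (Xb (k' : ℕ) (n' - k') (e + 2) w) (Yb (k' : ℕ) (n' - k') (e + 2) w)
          (Ξ₂ (Θb (k' : ℕ) (n' - k') (e + 2) w)) (Η₂ (Θb (k' : ℕ) (n' - k') (e + 2) w))))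
    (Q : (k' : Fin (n' + 1)) → Fin (m + 2) → KZ.IntegralRep ((k' : ℕ) + (n' - k') + (e + 1)))
    (hQd : ∀ k' a, (Q k' a).domain = KZ.cube ((k' : ℕ) + (n' - k') + (e + 1)))
    (hQi : ∀ k' a, (Q k' a).integrand = fun w => ρ (Θb (k' : ℕ) (n' - k') (e + 1) w) *
      (fd a (Ξ₁ (Θb (k' : ℕ) (n' - k') (e + 1) w)) (Η₁ (Θb (k' : ℕ) (n' - k') (e + 1) w)) *
          Bf (μ ∘ₗ op a) (Xb (k' : ℕ) (n' - k') (e + 1) w) (Yb (k' : ℕ) (n' - k') (e + 1) w)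
            (Ξ₁ (Θb (k' : ℕ) (n' - k') (e + 1) w)) (Η₁ (Θb (k' : ℕ) (n' - k') (e + 1) w)) -
        fd a (Ξ₁ (Θb (k' : ℕ) (n' - k') (e + 1) w)) 0 *
          Bf (μ ∘ₗ op a) (Xb (k' : ℕ) (n' - k') (e + 1) w) (Yb (k' : ℕ) (n' - k') (e + 1) w)
            (Ξ₁ (Θb (k' : ℕ) (n' - k') (e + 1) w)) 0))
    (E : (k'' : Fin n') → Fin (m + 2) → KZ.IntegralRep ((k'' : ℕ) + (n' - 1 - k'') + (e + 2)))
    (hEd : ∀ k'' a, (E k'' a).domain = KZ.cube ((k'' : ℕ) + (n' - 1 - k'') + (e + 2)))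
    (hEi : ∀ k'' a, (E k'' a).integrand = fun w => ρ₂ (Θb (k'' : ℕ) (n' - 1 - k'') (e + 2) w) *
      (fd a (Ξ₂ (Θb (k'' : ℕ) (n' - 1 - k'') (e + 2) w)) (Η₂ (Θb (k'' : ℕ) (n' - 1 - k'') (e + 2) w)) *
        ∑ b : Fin (m + 2), gd b (Ξ₂ (Θb (k'' : ℕ) (n' - 1 - k'') (e + 2) w)) (Η₂ (Θb (k'' : ℕ) (n' - 1 - k'') (e + 2) w)) *
          Bf ((μ ∘ₗ op a) ∘ₗ opV b) (Xb (k'' : ℕ) (n' - 1 - k'') (e + 2) w) (Yb (k'' : ℕ) (n' - 1 - k'') (e + 2) w)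
            (Ξ₂ (Θb (k'' : ℕ) (n' - 1 - k'') (e + 2) w)) (Η₂ (Θb (k'' : ℕ) (n' - 1 - k'') (e + 2) w)))) :
    ∑ k' : Fin (n' + 1), (∑ a ∈ Finset.univ.erase ℓ, KZ.toPeriodAlgebra (KZ.toFormalPeriod (KZ.of (W₂ k' a))) + KZ.toPeriodAlgebra (KZ.toFormalPeriod (KZ.of (Q k' ℓ)))) =
      ∑ k'' : Fin n', ∑ a : Fin (m + 2), KZ.toPeriodAlgebra (KZ.toFormalPeriod (KZ.of (E k'' a))) := by
  -- direct side: Euler step / direct route, and the vanishing of the last index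
  have hE_cast : ∀ (k'' : Fin n') (a : Fin (m + 2)), a ≠ ℓ → KZ.toPeriodAlgebra (KZ.toFormalPeriod (KZ.of (W₂ (Fin.castSucc k'') a))) = KZ.toPeriodAlgebra (KZ.toFormalPeriod (KZ.of (E k'' a))) := by
    intro k'' a ha
    obtain ⟨W, hWd, hWi, hWc⟩ := recast_rep_eq (e := e + 2) (k₁ := ((Fin.castSucc k'' : Fin (n' + 1)) : ℕ))
      (k₂ := (k'' : ℕ)) (l₁ := n' - ((Fin.castSucc k'' : Fin (n' + 1)) : ℕ)) (l₂ := n' - 1 - k'' + 1)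
      (by simp) (by simp; omega)
      (fun k l w => ρ₂ (Θb k l (e + 2) w) * (fd a (Ξ₂ (Θb k l (e + 2) w)) (Η₂ (Θb k l (e + 2) w)) *
        dBf (μ ∘ₗ op a) (Xb k l (e + 2) w) (Yb k l (e + 2) w) (Ξ₂ (Θb k l (e + 2) w)) (Η₂ (Θb k l (e + 2) w))))
      (W₂ (Fin.castSucc k'') a) (hW₂d _ a) (hW₂i _ a ha)
    rw [← hWc]
    exact stepA_euler H μ k'' (n' - 1 - k'') e Ξ Η σ' hΞΗ hσ'0 hsaΞ hsaΗ hsaσ' a Ξ₂ Η₂ ρ₂ hΞ₂ hΗ₂ hρ₂ W hWd hWi (E k'' a) (hEd k'' a) (hEi k'' a)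
  have hE_last : ∀ a : Fin (m + 2), a ≠ ℓ → KZ.toPeriodAlgebra (KZ.toFormalPeriod (KZ.of (W₂ (Fin.last n') a))) = 0 := by
    intro a ha
    obtain ⟨W, hWd, hWi, hWc⟩ := recast_rep_eq (e := e + 2) (k₁ := ((Fin.last n' : Fin (n' + 1)) : ℕ))
      (k₂ := n') (l₁ := n' - ((Fin.last n' : Fin (n' + 1)) : ℕ)) (l₂ := 0) (by simp) (by simp)
      (fun k l w => ρ₂ (Θb k l (e + 2) w) * (fd a (Ξ₂ (Θb k l (e + 2) w)) (Η₂ (Θb k l (e + 2) w)) *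
        dBf (μ ∘ₗ op a) (Xb k l (e + 2) w) (Yb k l (e + 2) w) (Ξ₂ (Θb k l (e + 2) w)) (Η₂ (Θb k l (e + 2) w))))
      (W₂ (Fin.last n') a) (hW₂d _ a) (hW₂i _ a ha)
    rw [← hWc]
    exact stepA_euler_nil H μ n' e a Ξ₂ Η₂ ρ₂ W hWd hWi
  have hQ_cast : ∀ k'' : Fin n', KZ.toPeriodAlgebra (KZ.toFormalPeriod (KZ.of (Q (Fin.castSucc k'') ℓ))) = KZ.toPeriodAlgebra (KZ.toFormalPeriod (KZ.of (E k'' ℓ))) := by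
    intro k''
    obtain ⟨W, hWd, hWi, hWc⟩ := recast_rep_eq (e := e + 1) (k₁ := ((Fin.castSucc k'' : Fin (n' + 1)) : ℕ))
      (k₂ := (k'' : ℕ)) (l₁ := n' - ((Fin.castSucc k'' : Fin (n' + 1)) : ℕ)) (l₂ := n' - 1 - k'' + 1)
      (by simp) (by simp; omega)
      (fun k l w => ρ (Θb k l (e + 1) w) * (fd ℓ (Ξ₁ (Θb k l (e + 1) w)) (Η₁ (Θb k l (e + 1) w)) *
          Bf (μ ∘ₗ op ℓ) (Xb k l (e + 1) w) (Yb k l (e + 1) w) (Ξ₁ (Θb k l (e + 1) w)) (Η₁ (Θb k l (e + 1) w)) -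
        fd ℓ (Ξ₁ (Θb k l (e + 1) w)) 0 *
          Bf (μ ∘ₗ op ℓ) (Xb k l (e + 1) w) (Yb k l (e + 1) w) (Ξ₁ (Θb k l (e + 1) w)) 0))
      (Q (Fin.castSucc k'') ℓ) (hQd _ ℓ) (hQi _ ℓ)
    rw [← hWc]
    exact stepA_direct H μ k'' (n' - 1 - k'') e Ξ Η σ' hΞΗ hσ'0 Ξ₁ Η₁ ρ hΞ₁ hΗ₁ hρ Ξ₂ Η₂ ρ₂ hΞ₂ hΗ₂ hρ₂ W hWd hWi (E k'' ℓ) (hEd k'' ℓ) (hEi k'' ℓ)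
  have hQ_last : KZ.toPeriodAlgebra (KZ.toFormalPeriod (KZ.of (Q (Fin.last n') ℓ))) = 0 := by
    obtain ⟨W, hWd, hWi, hWc⟩ := recast_rep_eq (e := e + 1) (k₁ := ((Fin.last n' : Fin (n' + 1)) : ℕ))
      (k₂ := n') (l₁ := n' - ((Fin.last n' : Fin (n' + 1)) : ℕ)) (l₂ := 0) (by simp) (by simp)
      (fun k l w => ρ (Θb k l (e + 1) w) * (fd ℓ (Ξ₁ (Θb k l (e + 1) w)) (Η₁ (Θb k l (e + 1) w)) *
          Bf (μ ∘ₗ op ℓ) (Xb k l (e + 1) w) (Yb k l (e + 1) w) (Ξ₁ (Θb k l (e + 1) w)) (Η₁ (Θb k l (e + 1) w)) -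
        fd ℓ (Ξ₁ (Θb k l (e + 1) w)) 0 *
          Bf (μ ∘ₗ op ℓ) (Xb k l (e + 1) w) (Yb k l (e + 1) w) (Ξ₁ (Θb k l (e + 1) w)) 0))
      (Q (Fin.last n') ℓ) (hQd _ ℓ) (hQi _ ℓ)
    rw [← hWc]
    exact stepA_direct_nil H μ n' e Ξ₁ Η₁ ρ W hWd hWi
  rw [Fin.sum_univ_castSucc, hQ_last, add_zero, Finset.sum_eq_zero (fun a ha => hE_last a (Finset.mem_erase.1 ha).1),
    add_zero]
  refine Finset.sum_congr rfl fun k'' _ => ?_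
  rw [hQ_cast k'', Finset.sum_congr rfl (fun a ha => hE_cast k'' a (Finset.mem_erase.1 ha).1),
    Finset.sum_erase_add _ _ (Finset.mem_univ ℓ)]

include H in
/-- **The level-`(n−2)` terms of one side, summed over the degree — reversed indexing** (degrees
`(n'−k₂, k₂)`; used for the mirror side): indices `succ k''` carry the level-`(n−2)` terms, the
index `0` vanishes. [cite: KontsevichZagier2001, §1.2 rules (2), (3)] -/
theorem low_side_rev (μ : (DrinfeldKohnoTrunc ℚ (Fin 4) N) →ₗ[ℚ] ℚ) (n' e : ℕ) (Ξ Η σ' : (Fin e → ℝ) → ℝ)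
    (hΞΗ : ∀ θ ∈ KZ.cube e, 0 ≤ Ξ θ ∧ Ξ θ ≤ (α : ℝ) ∧ 0 ≤ Η θ ∧ Η θ ≤ (β : ℝ))
    (hσ'0 : ∀ θ ∈ KZ.cube e, Ξ θ = 0 ∨ Η θ = 0 → σ' θ = 0)
    (hsaΞ : IsSemialgebraicFunOn ℚ (KZ.cube e) Ξ) (hsaΗ : IsSemialgebraicFunOn ℚ (KZ.cube e) Η)
    (hsaσ' : IsSemialgebraicFunOn ℚ (KZ.cube e) σ')
    (Ξ₁ Η₁ ρ : (Fin (e + 1) → ℝ) → ℝ)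
    (hΞ₁ : ∀ θ', Ξ₁ θ' = Ξ (Fin.init θ') * θ' (Fin.last e)) (hΗ₁ : ∀ θ', Η₁ θ' = Η (Fin.init θ'))
    (hρ : ∀ θ', ρ θ' = σ' (Fin.init θ') * Ξ (Fin.init θ'))
    (Ξ₂ Η₂ ρ₂ : (Fin (e + 2) → ℝ) → ℝ)
    (hΞ₂ : ∀ θ'', Ξ₂ θ'' = Ξ (Fin.init (Fin.init θ'')) * θ'' (Fin.castSucc (Fin.last e)))
    (hΗ₂ : ∀ θ'', Η₂ θ'' = Η (Fin.init (Fin.init θ'')) * θ'' (Fin.last (e + 1)))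
    (hρ₂ : ∀ θ'', ρ₂ θ'' = σ' (Fin.init (Fin.init θ'')) * Ξ (Fin.init (Fin.init θ'')) * Η (Fin.init (Fin.init θ'')))
    (W₂ : (k₂ : Fin (n' + 1)) → Fin (m + 2) → KZ.IntegralRep (n' - (k₂ : ℕ) + k₂ + (e + 2)))
    (hW₂d : ∀ k₂ a, (W₂ k₂ a).domain = KZ.cube (n' - (k₂ : ℕ) + k₂ + (e + 2)))
    (hW₂i : ∀ k₂ a, a ≠ ℓ → (W₂ k₂ a).integrand = fun w => ρ₂ (Θb (n' - (k₂ : ℕ)) k₂ (e + 2) w) *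
      (fd a (Ξ₂ (Θb (n' - (k₂ : ℕ)) k₂ (e + 2) w)) (Η₂ (Θb (n' - (k₂ : ℕ)) k₂ (e + 2) w)) *
        dBf (μ ∘ₗ op a) (Xb (n' - (k₂ : ℕ)) k₂ (e + 2) w) (Yb (n' - (k₂ : ℕ)) k₂ (e + 2) w)
          (Ξ₂ (Θb (n' - (k₂ : ℕ)) k₂ (e + 2) w)) (Η₂ (Θb (n' - (k₂ : ℕ)) k₂ (e + 2) w))))
    (Q : (k₂ : Fin (n' + 1)) → Fin (m + 2) → KZ.IntegralRep (n' - (k₂ : ℕ) + k₂ + (e + 1)))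
    (hQd : ∀ k₂ a, (Q k₂ a).domain = KZ.cube (n' - (k₂ : ℕ) + k₂ + (e + 1)))
    (hQi : ∀ k₂ a, (Q k₂ a).integrand = fun w => ρ (Θb (n' - (k₂ : ℕ)) k₂ (e + 1) w) *
      (fd a (Ξ₁ (Θb (n' - (k₂ : ℕ)) k₂ (e + 1) w)) (Η₁ (Θb (n' - (k₂ : ℕ)) k₂ (e + 1) w)) *
          Bf (μ ∘ₗ op a) (Xb (n' - (k₂ : ℕ)) k₂ (e + 1) w) (Yb (n' - (k₂ : ℕ)) k₂ (e + 1) w)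
            (Ξ₁ (Θb (n' - (k₂ : ℕ)) k₂ (e + 1) w)) (Η₁ (Θb (n' - (k₂ : ℕ)) k₂ (e + 1) w)) -
        fd a (Ξ₁ (Θb (n' - (k₂ : ℕ)) k₂ (e + 1) w)) 0 *
          Bf (μ ∘ₗ op a) (Xb (n' - (k₂ : ℕ)) k₂ (e + 1) w) (Yb (n' - (k₂ : ℕ)) k₂ (e + 1) w)
            (Ξ₁ (Θb (n' - (k₂ : ℕ)) k₂ (e + 1) w)) 0))
    (E : (k'' : Fin n') → Fin (m + 2) → KZ.IntegralRep (n' - 1 - (k'' : ℕ) + k'' + (e + 2)))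
    (hEd : ∀ k'' a, (E k'' a).domain = KZ.cube (n' - 1 - (k'' : ℕ) + k'' + (e + 2)))
    (hEi : ∀ k'' a, (E k'' a).integrand = fun w => ρ₂ (Θb (n' - 1 - (k'' : ℕ)) k'' (e + 2) w) *
      (fd a (Ξ₂ (Θb (n' - 1 - (k'' : ℕ)) k'' (e + 2) w)) (Η₂ (Θb (n' - 1 - (k'' : ℕ)) k'' (e + 2) w)) *
        ∑ b : Fin (m + 2), gd b (Ξ₂ (Θb (n' - 1 - (k'' : ℕ)) k'' (e + 2) w)) (Η₂ (Θb (n' - 1 - (k'' : ℕ)) k'' (e + 2) w)) *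
          Bf ((μ ∘ₗ op a) ∘ₗ opV b) (Xb (n' - 1 - (k'' : ℕ)) k'' (e + 2) w) (Yb (n' - 1 - (k'' : ℕ)) k'' (e + 2) w)
            (Ξ₂ (Θb (n' - 1 - (k'' : ℕ)) k'' (e + 2) w)) (Η₂ (Θb (n' - 1 - (k'' : ℕ)) k'' (e + 2) w)))) :
    ∑ k₂ : Fin (n' + 1), (∑ b ∈ Finset.univ.erase ℓ, KZ.toPeriodAlgebra (KZ.toFormalPeriod (KZ.of (W₂ k₂ b))) + KZ.toPeriodAlgebra (KZ.toFormalPeriod (KZ.of (Q k₂ ℓ)))) =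
      ∑ k'' : Fin n', ∑ b : Fin (m + 2), KZ.toPeriodAlgebra (KZ.toFormalPeriod (KZ.of (E k'' b))) := by
  -- mirror side: the same, indices `succ k''` and `0`
  have hE_succ : ∀ (k'' : Fin n') (b : Fin (m + 2)), b ≠ ℓ → KZ.toPeriodAlgebra (KZ.toFormalPeriod (KZ.of (W₂ (Fin.succ k'') b))) = KZ.toPeriodAlgebra (KZ.toFormalPeriod (KZ.of (E k'' b))) := by
    intro k'' b hb
    obtain ⟨W, hWd, hWi, hWc⟩ := recast_rep_eq (e := e + 2) (k₁ := n' - ((Fin.succ k'' : Fin (n' + 1)) : ℕ))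
      (k₂ := n' - 1 - k'') (l₁ := ((Fin.succ k'' : Fin (n' + 1)) : ℕ)) (l₂ := (k'' : ℕ) + 1)
      (by simp; omega) (by simp)
      (fun k l w => ρ₂ (Θb k l (e + 2) w) * (fd b (Ξ₂ (Θb k l (e + 2) w)) (Η₂ (Θb k l (e + 2) w)) *
        dBf (μ ∘ₗ op b) (Xb k l (e + 2) w) (Yb k l (e + 2) w) (Ξ₂ (Θb k l (e + 2) w)) (Η₂ (Θb k l (e + 2) w))))
      (W₂ (Fin.succ k'') b) (hW₂d _ b) (hW₂i _ b hb)
    rw [← hWc]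
    exact stepA_euler H μ (n' - 1 - k'') k'' e Ξ Η σ' hΞΗ hσ'0 hsaΞ hsaΗ hsaσ' b Ξ₂ Η₂ ρ₂
      hΞ₂ hΗ₂ hρ₂ W hWd hWi (E k'' b) (hEd k'' b) (hEi k'' b)
  have hE_zero : ∀ b : Fin (m + 2), b ≠ ℓ → KZ.toPeriodAlgebra (KZ.toFormalPeriod (KZ.of (W₂ 0 b))) = 0 := by
    intro b hb
    obtain ⟨W, hWd, hWi, hWc⟩ := recast_rep_eq (e := e + 2) (k₁ := n' - ((0 : Fin (n' + 1)) : ℕ))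
      (k₂ := n') (l₁ := ((0 : Fin (n' + 1)) : ℕ)) (l₂ := 0) (by simp) (by simp)
      (fun k l w => ρ₂ (Θb k l (e + 2) w) * (fd b (Ξ₂ (Θb k l (e + 2) w)) (Η₂ (Θb k l (e + 2) w)) *
        dBf (μ ∘ₗ op b) (Xb k l (e + 2) w) (Yb k l (e + 2) w) (Ξ₂ (Θb k l (e + 2) w)) (Η₂ (Θb k l (e + 2) w))))
      (W₂ 0 b) (hW₂d _ b) (hW₂i _ b hb)
    rw [← hWc]
    exact stepA_euler_nil H μ n' e b Ξ₂ Η₂ ρ₂ W hWd hWi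
  have hQ_succ : ∀ k'' : Fin n', KZ.toPeriodAlgebra (KZ.toFormalPeriod (KZ.of (Q (Fin.succ k'') ℓ))) = KZ.toPeriodAlgebra (KZ.toFormalPeriod (KZ.of (E k'' ℓ))) := by
    intro k''
    obtain ⟨W, hWd, hWi, hWc⟩ := recast_rep_eq (e := e + 1) (k₁ := n' - ((Fin.succ k'' : Fin (n' + 1)) : ℕ))
      (k₂ := n' - 1 - k'') (l₁ := ((Fin.succ k'' : Fin (n' + 1)) : ℕ)) (l₂ := (k'' : ℕ) + 1)
      (by simp; omega) (by simp)
      (fun k l w => ρ (Θb k l (e + 1) w) * (fd ℓ (Ξ₁ (Θb k l (e + 1) w)) (Η₁ (Θb k l (e + 1) w)) *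
          Bf (μ ∘ₗ op ℓ) (Xb k l (e + 1) w) (Yb k l (e + 1) w) (Ξ₁ (Θb k l (e + 1) w)) (Η₁ (Θb k l (e + 1) w)) -
        fd ℓ (Ξ₁ (Θb k l (e + 1) w)) 0 *
          Bf (μ ∘ₗ op ℓ) (Xb k l (e + 1) w) (Yb k l (e + 1) w) (Ξ₁ (Θb k l (e + 1) w)) 0))
      (Q (Fin.succ k'') ℓ) (hQd _ ℓ) (hQi _ ℓ)
    rw [← hWc]
    exact stepA_direct H μ (n' - 1 - k'') k'' e Ξ Η σ' hΞΗ hσ'0 Ξ₁ Η₁ ρ hΞ₁ hΗ₁ hρ Ξ₂ Η₂ ρ₂ hΞ₂ hΗ₂ hρ₂ W hWd hWi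
      (E k'' ℓ) (hEd k'' ℓ) (hEi k'' ℓ)
  have hQ_zero : KZ.toPeriodAlgebra (KZ.toFormalPeriod (KZ.of (Q 0 ℓ))) = 0 := by
    obtain ⟨W, hWd, hWi, hWc⟩ := recast_rep_eq (e := e + 1) (k₁ := n' - ((0 : Fin (n' + 1)) : ℕ))
      (k₂ := n') (l₁ := ((0 : Fin (n' + 1)) : ℕ)) (l₂ := 0) (by simp) (by simp)
      (fun k l w => ρ (Θb k l (e + 1) w) * (fd ℓ (Ξ₁ (Θb k l (e + 1) w)) (Η₁ (Θb k l (e + 1) w)) *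
          Bf (μ ∘ₗ op ℓ) (Xb k l (e + 1) w) (Yb k l (e + 1) w) (Ξ₁ (Θb k l (e + 1) w)) (Η₁ (Θb k l (e + 1) w)) -
        fd ℓ (Ξ₁ (Θb k l (e + 1) w)) 0 *
          Bf (μ ∘ₗ op ℓ) (Xb k l (e + 1) w) (Yb k l (e + 1) w) (Ξ₁ (Θb k l (e + 1) w)) 0))
      (Q 0 ℓ) (hQd _ ℓ) (hQi _ ℓ)
    rw [← hWc]
    exact stepA_direct_nil H μ n' e Ξ₁ Η₁ ρ W hWd hWi
  rw [Fin.sum_univ_succ, hQ_zero, add_zero, Finset.sum_eq_zero (fun b hb => hE_zero b (Finset.mem_erase.1 hb).1),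
    zero_add]
  refine Finset.sum_congr rfl fun k'' _ => ?_
  rw [hQ_succ k'', Finset.sum_congr rfl (fun b hb => hE_succ k'' b (Finset.mem_erase.1 hb).1),
    Finset.sum_erase_add _ _ (Finset.mem_univ ℓ)]

end AbstractEngine

/-- **Hook `cornerEngineLow_cast`**: the reversed indexing arithmetic of the mirror side. [folklore] -/
theorem cornerEngineLow_cast : ∀ (n : ℕ) (k : Fin n), n - ((Fin.succ k : Fin (n + 1)) : ℕ) = n - 1 - (k : ℕ) :=
  fun n k => by simp; omega

end Summit.KontsevichZagierPeriods.FurushoPentagon.PentagonInKZ
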